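import Literature.MathematicalPhysics.QuantumFieldTheory.Balaban1983to89.B9CoReadingCoordsGlob
import Literature.MathematicalPhysics.QuantumFieldTheory.Balaban1983to89.B9CoReadingCoordsS
import Literature.MathematicalPhysics.QuantumFieldTheory.Balaban1983to89.B9CoReadingCoordsL2

/-!
# BalabanUVNodes ∕ N06 ([B9], `Dag.B9_main`) — THE (3.42)∕(3.47) CO-READINGS OF WALK LETTERS PINNED TO THE κ-FOLD COORDINATE MODELS (member-free lemmas)

Track A of `YM-PLAN.md` (cell `pub-ymgap`, HUMAN RULING D-0062), node **N06** = [Balaban1985BackgroundPropagators] Thms 3.1–3.15; seat `pub-ymgap-dag-n06-d` gen 5.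

THE POINT.  The N06 certificates at def-Y's instances (`…N06AtOpsYOfRecordV4ECoordsS` and successors) display random-walk letters `𝔬` (Thm 3.7 ∕ 3.10 ∕ 3.12–3.13
expansions) whose block maps and operators are PINNED to the coordinate models of the genuine letters (`B9CoReadingCoords`, `B9CoReadingCoordsGlob`, `B9CoReadingCoordsS`):
`blk = blkBK i bI`, `G = GcoK i b B cfg O U`, `D = DcoK …`, `D* = DscoK …`, `Δ = LcoK …` (bond sector), resp. `blk = blkSK i (sIK i bI)`, `GcoS ∕ DcoS ∕ DscoS ∕ LcoS`
(site sector).  Under such pins every repaired (3.42) co-reading `CoRealizesRel … (RelB i) …`, every (3.47) co-reading `CoReadsGlob …` and every (3.47) reading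
`GlobReads …` of the entries `O`, `∇O`, `O∇*`, `ΔO` is a THEOREM of the coordinate modules.  This file packages them ONCE, for an arbitrary level index `i`, background
`B`, letter `O`, transporter `par`, basis `b` and carrier-∕level-faithful block map `bI`, with the walk-letter data abstracted to bare block maps and operators — so that a
certificate obtains its 8 + 8 + 27 co-readings by five applications instead of forty-three rewrites (heartbeat and line budget of the 400-line knit files).
* `bond_coReadings3_of_pins` — bond sector, entries 0–2: `CoRealizesRel` ×3, `CoReadsGlob` ×3, `GlobReads` ×3;
* `bond_coReadingsLap_of_pins` — bond sector, entry 3 (`ΔO`): `CoRealizesRel`, `CoReadsGlob`, `GlobReads`;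
* `site_coReadings4_of_pins` — site sector, entries 0–3: `CoRealizesRel` ×4, `GlobReads` ×4 (through `sIK_faithful ∕ sIK_level`);
* `bond_l2ReadsNbr3_of_pins` — bond sector, the (3.46) L² lines 0–2 in n06-k's radius-2 Nbr species `L2ReadsNbr … 2 √((d+1)|κ|) …` (n06-k g8
  `B9CoReadingCoordsL2`, p509367), given moreover that `bI` is 1-faithful (`hβ1`).
HONEST FRAMING.  Kernel bookkeeping over the landed coordinate modules (n06-d p498421 ∕ p501046 ∕ p508027, n06-k p509367); nothing of [B9] asserted; COUNT-NEUTRAL; N06 NOT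
discharged; one finite 𝕋⁴ programme at fixed `ε` — NOT ℝ⁴ ∕ OS ∕ mass gap ∕ Clay.  0 `def`, 0 `sorry`.
-/

noncomputable section

namespace Summit.QuantumFields.YangMills.BalabanUVNodes.N06CoReadingsOfPins

open Literature.MathematicalPhysics.QuantumFieldTheory.Balaban1983to89
open Literature.MathematicalPhysics.QuantumFieldTheory.Balaban1983to89.B6GlobalChartV1 (blkV1)
open Literature.MathematicalPhysics.QuantumFieldTheory.Balaban1983to89.B6Geom246MultiLevelTorus (geomT)
open Literature.MathematicalPhysics.QuantumFieldTheory.Balaban1983to89.B9RWSumsReadsNbr (L2ReadsNbr)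
open Literature.MathematicalPhysics.QuantumFieldTheory.Balaban1983to89.B9CoReadingCoordsL2 (l2ReadsNbr_kernelFamilyB_coords_zero l2ReadsNbr_kernelFamilyB_coords_one l2ReadsNbr_kernelFamilyB_coords_two)
open Literature.MathematicalPhysics.QuantumFieldTheory.Balaban1983to89.B6Ineq2142KLevelV1 (β lvl)
open Literature.MathematicalPhysics.QuantumFieldTheory.Balaban1983to89.B6KLevelCensusIndexV1 (KIdx)
open Literature.MathematicalPhysics.QuantumFieldTheory.Balaban1983to89.B9CoRealizesRel (CoRealizesRel)
open Literature.MathematicalPhysics.QuantumFieldTheory.Balaban1983to89.B9CoRealizesRelAtLetters (RelB)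
open Literature.MathematicalPhysics.QuantumFieldTheory.Balaban1983to89.B9Ineq347CoReading (CoReadsGlob)
open Literature.MathematicalPhysics.QuantumFieldTheory.Balaban1983to89.B9RWSums343to347Whole (GlobReads)
open Literature.MathematicalPhysics.QuantumFieldTheory.Balaban1983to89.Node00 (SiteY FBondY IBondY CfgY kernelFamilyB kernelFamilyS BondOpY BondParY SiteOpY SiteParY)
open Literature.MathematicalPhysics.QuantumFieldTheory.Balaban1983to89.B9CoReadingCoords (XBK evBK blkBK GcoK DcoK DscoK LcoK coRealizesRel_kernelFamilyB_coords_zero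
  coRealizesRel_kernelFamilyB_coords_one coRealizesRel_kernelFamilyB_coords_two coRealizesRel_kernelFamilyB_coords_three)
open Literature.MathematicalPhysics.QuantumFieldTheory.Balaban1983to89.B9CoReadingCoordsGlob (coReadsGlob_kernelFamilyB_coords_zero coReadsGlob_kernelFamilyB_coords_one
  coReadsGlob_kernelFamilyB_coords_two coReadsGlob_kernelFamilyB_coords_three globReads_kernelFamilyB_coords_zero globReads_kernelFamilyB_coords_one
  globReads_kernelFamilyB_coords_two globReads_kernelFamilyB_coords_three)
open Literature.MathematicalPhysics.QuantumFieldTheory.Balaban1983to89.B9CoReadingCoordsS (XSK evSK blkSK sIK sIK_faithful sIK_level GcoS DcoS DscoS LcoS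
  coRealizesRel_kernelFamilyS_coords_zero coRealizesRel_kernelFamilyS_coords_one coRealizesRel_kernelFamilyS_coords_two coRealizesRel_kernelFamilyS_coords_three
  globReads_kernelFamilyS_coords_zero globReads_kernelFamilyS_coords_one globReads_kernelFamilyS_coords_two globReads_kernelFamilyS_coords_three)

variable {d ℓ : ℕ} {hd : 1 ≤ d + 1} {hL : Odd (ℓ + 1) ∧ 1 < ℓ + 1} {b₀ b₁ : ℝ}
variable {𝔸 : Type} [NormedRing 𝔸] [NormedAlgebra ℂ 𝔸] [CompleteSpace 𝔸] [FiniteDimensional ℝ 𝔸]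
variable {κ : Type} [Fintype κ] [DecidableEq κ]

/-- **BOND SECTOR, ENTRIES 0–2 (`O`, `∇O`, `O∇*`) UNDER THE PINS**: for block maps `blk = blkY = blkBK i bI` over a carrier- and level-faithful `bI` and operators
`G = GcoK …`, `D = DcoK …`, `Ds = DscoK …` (the coordinate models of the letter `O` and of `∇_U`, `∇*_U` at `U`), the three repaired (3.42) co-readings, the
three (3.47) co-readings and the three (3.47) readings of def-Y's bond-sector family `kernelFamilyB i B cfg O par` HOLD.
[cite: Balaban1985BackgroundPropagators, (3.42) p.397, (3.47) p.398; Balaban1984PropagatorsII, (2.51) p.232, (2.67) p.234] -/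
theorem bond_coReadings3_of_pins (i : KIdx d ℓ hd hL b₀ b₁) (b : Module.Basis κ ℝ 𝔸) (B : B9.Backgrounds) (cfg : B.Cfg → CfgY 𝔸 i) (O : BondOpY 𝔸 i)
    (par : BondParY 𝔸 i) (U : B.Cfg) {bI : FBondY i → IBondY i}
    (hβI : ∀ (x : FBondY i) (c : IBondY i), blkV1 i.hN i.D x = β i.hN i.D i.hk c → β i.hN i.D i.hk (bI x) = blkV1 i.hN i.D x)
    (hlev : ∀ x : FBondY i, lvl i.hN i.D i.hk (bI x) = (blkV1 i.hN i.D x).1.1)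
    {blk blkY : XBK κ i → IBondY i} {G D Ds : (XBK κ i → ℝ) →ₗ[ℝ] (XBK κ i → ℝ)} (hblk : blk = blkBK i bI) (hblkY : blkY = blkBK i bI)
    (hG : G = GcoK i b B cfg O U) (hD : D = DcoK i b B cfg U) (hDs : Ds = DscoK i b B cfg U) :
    CoRealizesRel (kernelFamilyB i B cfg O par) 0 U (RelB i) blk blk (evBK i) G ∧ CoRealizesRel (kernelFamilyB i B cfg O par) 1 U (RelB i) blkY blk (evBK i) (D ∘ₗ G) ∧
      CoRealizesRel (kernelFamilyB i B cfg O par) 2 U (RelB i) blk blkY (evBK i) (G ∘ₗ Ds) ∧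
      CoReadsGlob (kernelFamilyB i B cfg O par) 0 U blk blk (evBK i) G ∧ CoReadsGlob (kernelFamilyB i B cfg O par) 1 U blkY blk (evBK i) (D ∘ₗ G) ∧
      CoReadsGlob (kernelFamilyB i B cfg O par) 2 U blk blkY (evBK i) (G ∘ₗ Ds) ∧
      GlobReads (kernelFamilyB i B cfg O par) 0 U blk blk (evBK i) G ∧ GlobReads (kernelFamilyB i B cfg O par) 1 U blkY blk (evBK i) (D ∘ₗ G) ∧
      GlobReads (kernelFamilyB i B cfg O par) 2 U blk blkY (evBK i) (G ∘ₗ Ds) := by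
  subst hblk hblkY hG hD hDs
  exact ⟨coRealizesRel_kernelFamilyB_coords_zero i b B cfg O par U hβI, coRealizesRel_kernelFamilyB_coords_one i b B cfg O par U hβI,
    coRealizesRel_kernelFamilyB_coords_two i b B cfg O par U hβI, coReadsGlob_kernelFamilyB_coords_zero i b B cfg O par U hlev,
    coReadsGlob_kernelFamilyB_coords_one i b B cfg O par U hlev, coReadsGlob_kernelFamilyB_coords_two i b B cfg O par U hlev,
    globReads_kernelFamilyB_coords_zero i b B cfg O par U hlev, globReads_kernelFamilyB_coords_one i b B cfg O par U hlev,
    globReads_kernelFamilyB_coords_two i b B cfg O par U hlev⟩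

/-- **BOND SECTOR, ENTRY 3 (`ΔO`) UNDER THE PINS**: with `L = LcoK …` (the model of `Δ_U`), the repaired (3.42) co-reading, the (3.47) co-reading and the (3.47)
reading of the entry `Δ_U O(U)` HOLD. [cite: Balaban1985BackgroundPropagators, (3.42) p.397, (3.47) p.398; Balaban1984PropagatorsII, (2.51) p.232, (2.67) p.234] -/
theorem bond_coReadingsLap_of_pins (i : KIdx d ℓ hd hL b₀ b₁) (b : Module.Basis κ ℝ 𝔸) (B : B9.Backgrounds) (cfg : B.Cfg → CfgY 𝔸 i) (O : BondOpY 𝔸 i)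
    (par : BondParY 𝔸 i) (U : B.Cfg) {bI : FBondY i → IBondY i}
    (hβI : ∀ (x : FBondY i) (c : IBondY i), blkV1 i.hN i.D x = β i.hN i.D i.hk c → β i.hN i.D i.hk (bI x) = blkV1 i.hN i.D x)
    (hlev : ∀ x : FBondY i, lvl i.hN i.D i.hk (bI x) = (blkV1 i.hN i.D x).1.1)
    {blk : XBK κ i → IBondY i} {G L : (XBK κ i → ℝ) →ₗ[ℝ] (XBK κ i → ℝ)} (hblk : blk = blkBK i bI) (hG : G = GcoK i b B cfg O U) (hL' : L = LcoK i b B cfg U) :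
    CoRealizesRel (kernelFamilyB i B cfg O par) 3 U (RelB i) blk blk (evBK i) (L ∘ₗ G) ∧ CoReadsGlob (kernelFamilyB i B cfg O par) 3 U blk blk (evBK i) (L ∘ₗ G) ∧
      GlobReads (kernelFamilyB i B cfg O par) 3 U blk blk (evBK i) (L ∘ₗ G) := by
  subst hblk hG hL'
  exact ⟨coRealizesRel_kernelFamilyB_coords_three i b B cfg O par U hβI, coReadsGlob_kernelFamilyB_coords_three i b B cfg O par U hlev,
    globReads_kernelFamilyB_coords_three i b B cfg O par U hlev⟩

/-- **SITE SECTOR, ENTRIES 0–3 UNDER THE PINS**: for block maps `blk = blkY = blkSK i (sIK i bI)` over a carrier- and level-faithful `bI` (site-faithful through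
`sIK_faithful ∕ sIK_level`) and operators `G = GcoS …`, `D = DcoS …`, `Ds = DscoS …`, `L = LcoS …` (the coordinate models of the site letter `O` and of `∇_U`, `∇*_U`,
`Δ_U`, η-prefactors folded), the four repaired (3.42) co-readings and the four (3.47) readings of def-Y's site-sector family `kernelFamilyS i B cfg O par` HOLD.
[cite: Balaban1985BackgroundPropagators, (3.42) p.397, (3.47) p.398; Balaban1984PropagatorsII, (2.45) p.231, (2.51) p.232, (2.67) p.234] -/
theorem site_coReadings4_of_pins (i : KIdx d ℓ hd hL b₀ b₁) (b : Module.Basis κ ℝ 𝔸) (B : B9.Backgrounds) (cfg : B.Cfg → CfgY 𝔸 i) (O : SiteOpY 𝔸 i)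
    (par : SiteParY 𝔸 i) (U : B.Cfg) {bI : FBondY i → IBondY i}
    (hβI : ∀ (x : FBondY i) (c : IBondY i), blkV1 i.hN i.D x = β i.hN i.D i.hk c → β i.hN i.D i.hk (bI x) = blkV1 i.hN i.D x)
    (hlev : ∀ x : FBondY i, lvl i.hN i.D i.hk (bI x) = (blkV1 i.hN i.D x).1.1)
    {blk blkY : XSK κ i → IBondY i} {G D Ds L : (XSK κ i → ℝ) →ₗ[ℝ] (XSK κ i → ℝ)} (hblk : blk = blkSK i (sIK i bI)) (hblkY : blkY = blkSK i (sIK i bI))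
    (hG : G = GcoS i b B cfg O U) (hD : D = DcoS i b B cfg U) (hDs : Ds = DscoS i b B cfg U) (hL' : L = LcoS i b B cfg U) :
    CoRealizesRel (kernelFamilyS i B cfg O par) 0 U (RelB i) blk blk (evSK i) G ∧ CoRealizesRel (kernelFamilyS i B cfg O par) 1 U (RelB i) blkY blk (evSK i) (D ∘ₗ G) ∧
      CoRealizesRel (kernelFamilyS i B cfg O par) 2 U (RelB i) blk blkY (evSK i) (G ∘ₗ Ds) ∧ CoRealizesRel (kernelFamilyS i B cfg O par) 3 U (RelB i) blk blk (evSK i) (L ∘ₗ G) ∧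
      GlobReads (kernelFamilyS i B cfg O par) 0 U blk blk (evSK i) G ∧ GlobReads (kernelFamilyS i B cfg O par) 1 U blkY blk (evSK i) (D ∘ₗ G) ∧
      GlobReads (kernelFamilyS i B cfg O par) 2 U blk blkY (evSK i) (G ∘ₗ Ds) ∧ GlobReads (kernelFamilyS i B cfg O par) 3 U blk blk (evSK i) (L ∘ₗ G) := by
  subst hblk hblkY hG hD hDs hL'
  exact ⟨coRealizesRel_kernelFamilyS_coords_zero i b B cfg O par U (sIK_faithful i hβI), coRealizesRel_kernelFamilyS_coords_one i b B cfg O par U (sIK_faithful i hβI),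
    coRealizesRel_kernelFamilyS_coords_two i b B cfg O par U (sIK_faithful i hβI), coRealizesRel_kernelFamilyS_coords_three i b B cfg O par U (sIK_faithful i hβI),
    globReads_kernelFamilyS_coords_zero i b B cfg O par U (sIK_level i hlev), globReads_kernelFamilyS_coords_one i b B cfg O par U (sIK_level i hlev),
    globReads_kernelFamilyS_coords_two i b B cfg O par U (sIK_level i hlev), globReads_kernelFamilyS_coords_three i b B cfg O par U (sIK_level i hlev)⟩

/-- **BOND SECTOR, THE (3.46) L² LINES 0–2 IN THE RADIUS-2 Nbr SPECIES UNDER THE PINS** (n06-k `B9CoReadingCoordsL2`): with `bI` moreover 1-faithful (`hβ1`: the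
index bond chosen for a fine bond lies in its block or an adjacent one — forced by orphan blocks), the three `L2ReadsNbr … n U (RelB i) 2 √((d+1)|κ|) …` co-readings
of `O`, `∇O`, `O∇*` HOLD for the pinned block maps and model operators. [cite: Balaban1985BackgroundPropagators, (3.46) p.398, (3.39) p.397; Balaban1984PropagatorsII, (2.51)–(2.54) pp.232–233] -/
theorem bond_l2ReadsNbr3_of_pins (i : KIdx d ℓ hd hL b₀ b₁) [Fintype (B9GeoNormsKLevelV1.geo9K i).Site] [DecidableRel (RelB i)] (b : Module.Basis κ ℝ 𝔸)
    (B : B9.Backgrounds) (cfg : B.Cfg → CfgY 𝔸 i) (O : BondOpY 𝔸 i) (par : BondParY 𝔸 i) (U : B.Cfg) {R : ℝ} {H : Prop} {bI : FBondY i → IBondY i}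
    (hβI : ∀ (x : FBondY i) (c : IBondY i), blkV1 i.hN i.D x = β i.hN i.D i.hk c → β i.hN i.D i.hk (bI x) = blkV1 i.hN i.D x)
    (hβ1 : ∀ x : FBondY i, (geomT i.D).dist (β i.hN i.D i.hk (bI x)) (blkV1 i.hN i.D x) ≤ 1)
    {blk blkY : XBK κ i → IBondY i} {G D Ds : (XBK κ i → ℝ) →ₗ[ℝ] (XBK κ i → ℝ)} (hblk : blk = blkBK i bI) (hblkY : blkY = blkBK i bI)
    (hG : G = GcoK i b B cfg O U) (hD : D = DcoK i b B cfg U) (hDs : Ds = DscoK i b B cfg U) :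
    L2ReadsNbr (R := R) (H := H) (kernelFamilyB i B cfg O par) 0 U (RelB i) 2 (Real.sqrt ((d + 1) * Fintype.card κ)) blk blk (evBK i) G ∧
      L2ReadsNbr (R := R) (H := H) (kernelFamilyB i B cfg O par) 1 U (RelB i) 2 (Real.sqrt ((d + 1) * Fintype.card κ)) blkY blk (evBK i) (D ∘ₗ G) ∧
      L2ReadsNbr (R := R) (H := H) (kernelFamilyB i B cfg O par) 2 U (RelB i) 2 (Real.sqrt ((d + 1) * Fintype.card κ)) blk blkY (evBK i) (G ∘ₗ Ds) := by
  subst hblk hblkY hG hD hDs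
  exact ⟨l2ReadsNbr_kernelFamilyB_coords_zero i b B cfg O par U hβI hβ1 le_rfl, l2ReadsNbr_kernelFamilyB_coords_one i b B cfg O par U hβI hβ1 le_rfl,
    l2ReadsNbr_kernelFamilyB_coords_two i b B cfg O par U hβI hβ1 le_rfl⟩

end Summit.QuantumFields.YangMills.BalabanUVNodes.N06CoReadingsOfPins

end
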